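import Summits.ResolutionOfSingularities.ResolutionOfSingularities.Theorems.FrobeniusLadderFInjectiveMacaulayficationX2CubicFormFrontEnd
import Summits.ResolutionOfSingularities.ResolutionOfSingularities.Theorems.FrobeniusLadderFInjectiveMacaulayficationX2Cubic4Specimen
import Mathlib.RingTheory.MvPolynomial.EulerIdentity
import HarnessLib

/-!
# T-side CLASS ROW, scope: the vertex of `x² + F₃` (any cubic form `F₃ ≠ 0`) is a CLOSED, SINGULAR point of local dimension `4`; the class row bundled with its scope
# (crux `FInjectiveMacaulayfication` stmt-ResolutionOfSingularities-15315, chain w45a; companion of ✓p680932 `X2CubicFormFrontEnd.tStepInstanceAt_of_doublePoint_cubicForm`: the OUTER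
# hypotheses of the T″ stub at the base point — `y` closed, `y ∉ Reg`, (`dim = 4`) — hold for EVERY member of the class; FULLness of the vertex and of the floor stay per-bed
# (Fermat: ✓p678024 / ✓p677842); seat res-L1-w45a-lead-1 g11)

[OURS · L1 W4.5a] Support file (`--supports stmt-ResolutionOfSingularities-15315 --as helper`); def-free; UNCONDITIONAL; no named fact; NOT a statement of any manuscript. AI-written
(AI review is weaker than expert review).

* `eval_zero_pderiv_f` — `∇f(0) = 0` for `f = X₄² + F` (`∂ᵢF` is homogeneous of degree `2`, Mathlib `IsHomogeneous.pderiv`);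
* ★ `vertex_scope` — `v` closed ∧ `v ∉ Reg Y` ∧ `ringKrullDim 𝒪_{Y,v} = 4` (`f` prime, `F` a cubic form);
* ★★ `tStep_classRow_cubicForm` — SCOPE ∧ `TStepInstanceAt p v (𝔪̃·𝒪_{Y,v})` under the hypotheses of the front end (one citeable name; FULLness not included — per bed).
[folklore; cite: Hartshorne1977, I Thm. 5.1; Matsumura1987, Thm. 13.5]
-/

-- single-problem summit: the doubled namespace component is forced
set_option linter.dupNamespace false

noncomputable section

namespace Summit.ResolutionOfSingularities.ResolutionOfSingularities.Theorems.FInjectiveMacaulayfication.X2CubicFormScope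

open MvPolynomial Literature.AlgebraicGeometry.Resolution AlgebraicGeometry
open Summit.ResolutionOfSingularities.ResolutionOfSingularities.Theorems.FInjectiveMacaulayfication
open GermOfGlobalBlowup

variable (k : Type) [Field k]

/-- **`∇f(0) = 0`** for `f = X₄² + F`, `F` a cubic form: `∂ᵢ(X₄²) = 2X₄·δ` vanishes at `0`, and `∂ᵢ F` is homogeneous of degree `2`, so has no constant term. [elementary] -/
theorem eval_zero_pderiv_f (F : MvPolynomial (Fin 4) k) (hF : F.IsHomogeneous 3) (f : MvPolynomial (Fin 5) k)
    (hf : f = X 4 ^ 2 + rename (Fin.castSucc : Fin 4 → Fin 5) F) (i : Fin 5) : MvPolynomial.eval (0 : Fin 5 → k) (pderiv i f) = 0 := by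
  have hq : (rename (Fin.castSucc : Fin 4 → Fin 5) F).IsHomogeneous 3 := hF.rename_isHomogeneous
  have hqi : (pderiv i (rename (Fin.castSucc : Fin 4 → Fin 5) F)).IsHomogeneous 2 := hq.pderiv
  rw [hf, map_add, map_add, Derivation.leibniz_pow, MvPolynomial.eval_zero]
  rw [X2CubicFormFrontEnd.constantCoeff_eq_zero_of_isHomogeneous hqi (by norm_num), add_zero]
  simp

/-- ★ **SCOPE of the class**: for `f = X₄² + F` prime, `F` a cubic form, the vertex `v` of `Y = Spec k[X]/(f)` is CLOSED, SINGULAR (`f(0) = 0`, `∇f(0) = 0`), and `dim 𝒪_{Y,v} = 4`.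
[cite: Hartshorne1977, I Thm. 5.1] [cite: Matsumura1987, Thm. 13.5] -/
theorem vertex_scope (F : MvPolynomial (Fin 4) k) (hF : F.IsHomogeneous 3) (f : MvPolynomial (Fin 5) k) (hf : f = X 4 ^ 2 + rename (Fin.castSucc : Fin 4 → Fin 5) F)
    (hprime : Prime f) (v : Spec (.of (MvPolynomial (Fin 5) k ⧸ Ideal.span {f})))
    (hv : v.asIdeal = Ideal.span (Set.range fun j : Fin 5 => Ideal.Quotient.mk (Ideal.span {f}) (X j))) :
    IsClosed ({v} : Set (Spec (.of (MvPolynomial (Fin 5) k ⧸ Ideal.span {f})))) ∧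
      v ∉ Scheme.regularLocus (Spec (.of (MvPolynomial (Fin 5) k ⧸ Ideal.span {f}))) ∧
      ringKrullDim ((Spec (.of (MvPolynomial (Fin 5) k ⧸ Ideal.span {f}))).presheaf.stalk v) = (4 : ℕ) := by
  classical
  have hf0 := X2CubicFormFrontEnd.constantCoeff_f k F hF f hf
  refine ⟨DoublePointFermatCubicGerm.isClosed_origin k f hf0 v hv, ?_, ?_⟩
  · refine not_mem_regularLocus_Spec_of_not_isRegularLocalRing v ?_
    refine not_isRegularLocalRing_localization_of_pderiv_eval_eq_zero (0 : Fin 5 → k) hprime.ne_zero ?_ (eval_zero_pderiv_f k F hF f hf) v.asIdeal ?_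
    · rw [MvPolynomial.eval_zero]; exact hf0
    · rw [hv, DoublePointFermatCubicGerm.comap_origin k f hf0, MvPolynomial.eval_zero, Fedder.span_range_X_eq_ker]
  · haveI : v.asIdeal.IsMaximal := by rw [hv]; exact DoublePointFermatCubicGerm.isMaximal_origin k f hf0
    rw [ringKrullDim_stalk_Spec_eq]
    exact HypersurfaceLocalDim.stub_hypersurfaceLocalDim k 4 f hprime.ne_zero v.asIdeal

/-- ★★ **THE CLASS ROW WITH ITS SCOPE**: for every field `k`, every `p`, every cubic form `F` with `f = X₄² + F` prime, `Y` regular off the vertex `v`, and the four dehomogenisations prime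
with smooth zero locus: (`v` closed ∧ `v ∉ Reg Y` ∧ `dim 𝒪_{Y,v} = 4`) ∧ `TStepGerm.TStepInstanceAt p v (𝔪̃·𝒪_{Y,v})`. FULLness of `v` and of the point floor (the remaining outer
hypothesis of T″ and the instance's non-vacuity) are per-bed facts, not part of this theorem. [OURS · class-level certificate theorem] -/
theorem tStep_classRow_cubicForm (p : ℕ) (F : MvPolynomial (Fin 4) k) (hF : F.IsHomogeneous 3) (f : MvPolynomial (Fin 5) k)
    (hf : f = X 4 ^ 2 + rename (Fin.castSucc : Fin 4 → Fin 5) F) (hprime : Prime f)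
    (hoff : ∀ (P : Ideal (MvPolynomial (Fin 5) k ⧸ Ideal.span {f})) [P.IsPrime],
      ¬ Ideal.span (Set.range fun j : Fin 5 => Ideal.Quotient.mk (Ideal.span {f}) (X j)) ≤ P → IsRegularLocalRing (Localization.AtPrime P))
    (hw : ∀ a : Fin 4, Prime (MvPolynomial.aeval ((![![1, X 0, X 1, X 2], ![X 0, 1, X 1, X 2], ![X 0, X 1, 1, X 2], ![X 0, X 1, X 2, 1]] :
      Fin 4 → Fin 4 → MvPolynomial (Fin 3) k) a) F))
    (hws : ∀ (a : Fin 4) (Q : Ideal (MvPolynomial (Fin 3) k)), Q.IsPrime →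
      MvPolynomial.aeval ((![![1, X 0, X 1, X 2], ![X 0, 1, X 1, X 2], ![X 0, X 1, 1, X 2], ![X 0, X 1, X 2, 1]] : Fin 4 → Fin 4 → MvPolynomial (Fin 3) k) a) F ∈ Q →
      ∃ D : Derivation k (MvPolynomial (Fin 3) k) (MvPolynomial (Fin 3) k),
        D (MvPolynomial.aeval ((![![1, X 0, X 1, X 2], ![X 0, 1, X 1, X 2], ![X 0, X 1, 1, X 2], ![X 0, X 1, X 2, 1]] : Fin 4 → Fin 4 → MvPolynomial (Fin 3) k) a) F) ∉ Q)
    (v : Spec (.of (MvPolynomial (Fin 5) k ⧸ Ideal.span {f})))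
    (hv : v.asIdeal = Ideal.span (Set.range fun j : Fin 5 => Ideal.Quotient.mk (Ideal.span {f}) (X j))) :
    (IsClosed ({v} : Set (Spec (.of (MvPolynomial (Fin 5) k ⧸ Ideal.span {f})))) ∧
      v ∉ Scheme.regularLocus (Spec (.of (MvPolynomial (Fin 5) k ⧸ Ideal.span {f}))) ∧
      ringKrullDim ((Spec (.of (MvPolynomial (Fin 5) k ⧸ Ideal.span {f}))).presheaf.stalk v) = (4 : ℕ)) ∧
    TStepGerm.TStepInstanceAt p v ((affineBlowup.idealSheaf (Ideal.span (Set.range fun j : Fin 5 => Ideal.Quotient.mk (Ideal.span {f}) (X j)))).comap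
      ((Spec (.of (MvPolynomial (Fin 5) k ⧸ Ideal.span {f}))).fromSpecStalk v)) :=
  ⟨vertex_scope k F hF f hf hprime v hv, X2CubicFormFrontEnd.tStepInstanceAt_of_doublePoint_cubicForm k p F hF f hf hprime hoff hw hws v hv⟩

end Summit.ResolutionOfSingularities.ResolutionOfSingularities.Theorems.FInjectiveMacaulayfication.X2CubicFormScope

end
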